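import Literature.Analysis.FluidPDE.NSLocalAnalyticityRadiusForcing
import Literature.Analysis.FluidPDE.OseenDuhamelHeatDecay
import Literature.Analysis.FluidPDE.SpaceTimeCalculus
import HarnessLib

/-!
# The Oseen (mild) representation of the localised classical solution

Analysis/FluidPDE proofs-layer file (theorems only), module L3d of the proof of the named fact
`Literature.Analysis.FluidPDE.bradshawGrujicKukavica2015_local_analyticity_radius`
(Bradshaw–Grujić–Kukavica 2015, Thm. 2.3, §4). For a classical solution `(u, p)` of the
Navier–Stokes equations on the open cylinder `(-δ, R²) × B(x₁, R)` and an admissible cut-off `χ`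
(`NSLocalAnalyticityRadiusLocalisation.lean`), the localised field `v = χu` has, for
`-δ < s₀ ≤ t < R²`, the **Oseen representation**

  `v(t) = ∇π[v(t)] + e^{(t-s₀)Δ} P[v(s₀)] - B¹_{s₀}(v, ũ)(t) - B¹_{s₀}(2∇χ, ũ)(t)
            + ∫_{s₀}^{t} e^{(t-s)Δ} P[f₀(s)] ds`                    (`locVelocity_eq_representation`)

(`ũ = 1_{B(x₁,R-2)} u`, `f₀` the commutator force, `B¹_{s₀}` the Oseen–Duhamel bilinear term
`oseenDuhamel 1 s₀`, `P` the Leray projection of test fields). This is the localised integral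
equation (4.2)–(4.4) of Bradshaw–Grujić–Kukavica 2015, §4, written with the Oseen tensor instead
of the pressure (Lemarié-Rieusset 2016, Thm. 6.1: Oseen solutions).

Proof (Lemarié-Rieusset 2016, Thm. 6.1 / §6.3, uniqueness of Oseen solutions): the residual
`z = P[v(t)] - (datum - Duhamel terms + forcing)` is bounded, measurable, weakly divergence free,
and annihilates every smooth compactly supported divergence-free field — by the duality identity
for `v` (`integral_inner_locVelocity_eq_duality`) and the pairing identities of the heat datum
(symmetry of the heat semigroup and self-adjointness of `P` on solenoidal caloric tests), of the
Duhamel terms (`integral_inner_oseenDuhamel_of_isDivFree`) and of the forcing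
(`integral_inner_locForcing_eq`). Hence `z` is a.e. a constant (`BoundedAnnihilator`), and the
constant vanishes because every term tends to zero at the origin under the heat flow `e^{τΔ}`,
`τ → ∞` (Lemarié-Rieusset 2016, Def. 6.5); `z` being continuous, it vanishes identically.

## References

* Z. Bradshaw, Z. Grujić, I. Kukavica, J. Differential Equations 259 (2015), §4, (4.2)–(4.4).
  [BradshawGrujicKukavica2015]
* P. G. Lemarié-Rieusset, *The Navier–Stokes Problem in the 21st Century*, CRC Press 2016,
  Def. 6.5, Thm. 6.1, §6.3. [LemarieRieusset2016]
-/

noncomputable section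

open MeasureTheory Set Function Filter Metric Real
open _root_.Topology
open scoped ENNReal ContDiff Laplacian InnerProductSpace RealInnerProductSpace

namespace Literature.Analysis.FluidPDE

namespace BGK2015

variable {x₁ : EuclideanSpace ℝ (Fin 3)} {δ R : ℝ}
  {u : ℝ → EuclideanSpace ℝ (Fin 3) → EuclideanSpace ℝ (Fin 3)}
  {p : ℝ → EuclideanSpace ℝ (Fin 3) → ℝ} {χ : EuclideanSpace ℝ (Fin 3) → ℝ}

/-! ### The slab data: measurability and bounds of `v`, `ũ`, `2∇χ` on `(s₀, t) × ℝ³` -/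

section Slab

variable (hsol : IsCylinderSolution x₁ δ R u p) (hχ : IsLocCutoff x₁ R χ) {s₀ t : ℝ}
  (hI : Icc s₀ t ⊆ Ioo (-δ) (R ^ 2))
include hsol hχ hI

/-- `v` is a.e. strongly measurable on the slab `(s₀, t) × ℝ³`. [folklore] -/
theorem aestronglyMeasurable_uncurry_locVelocity :
    AEStronglyMeasurable (uncurry (locVelocity χ u))
      ((volume : Measure (ℝ × EuclideanSpace ℝ (Fin 3))).restrict (Ioo s₀ t ×ˢ univ)) :=
  ((isSmoothSpaceTimeOn_locVelocity hsol hχ).continuousOn.mono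
    (prod_mono (Ioo_subset_Icc_self.trans hI) subset_rfl)).aestronglyMeasurable
    (measurableSet_Ioo.prod MeasurableSet.univ)

omit hχ in
/-- `ũ = 1_{B(x₁,R-2)} u` is a.e. strongly measurable on the slab `(s₀, t) × ℝ³`. [folklore] -/
theorem aestronglyMeasurable_uncurry_locExtension :
    AEStronglyMeasurable (uncurry (locExtension x₁ R u))
      ((volume : Measure (ℝ × EuclideanSpace ℝ (Fin 3))).restrict (Ioo s₀ t ×ˢ univ)) := by
  have hunc : uncurry (locExtension x₁ R u) =
      ((univ : Set ℝ) ×ˢ ball x₁ (R - 2)).indicator (uncurry u) := by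
    funext z
    by_cases hz : z.2 ∈ ball x₁ (R - 2)
    · rw [uncurry, locExtension_of_mem hz, Set.indicator_of_mem (mk_mem_prod (mem_univ _) hz)]
      rfl
    · rw [uncurry, locExtension_of_notMem hz, Set.indicator_of_notMem (fun h => hz h.2)]
  rw [hunc, aestronglyMeasurable_indicator_iff (MeasurableSet.univ.prod measurableSet_ball),
    Measure.restrict_restrict (MeasurableSet.univ.prod measurableSet_ball)]
  have hset : (univ : Set ℝ) ×ˢ ball x₁ (R - 2) ∩ Ioo s₀ t ×ˢ univ = Ioo s₀ t ×ˢ ball x₁ (R - 2) := by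
    rw [prod_inter_prod, univ_inter, inter_univ]
  rw [hset]
  have hsub : Ioo s₀ t ×ˢ ball x₁ (R - 2) ⊆ Ioo (-δ) (R ^ 2) ×ˢ ball x₁ R :=
    prod_mono (Ioo_subset_Icc_self.trans hI) (ball_subset_ball (by linarith))
  exact (hsol.continuousOn_velocity.mono hsub).aestronglyMeasurable
    (measurableSet_Ioo.prod measurableSet_ball)

omit hsol hI in
/-- The constant-in-time field `2∇χ` is a.e. strongly measurable on every slab. [folklore] -/
theorem aestronglyMeasurable_uncurry_gradCutoff (S : Set (ℝ × EuclideanSpace ℝ (Fin 3))) :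
    AEStronglyMeasurable (uncurry fun (_ : ℝ) (y : EuclideanSpace ℝ (Fin 3)) => (2 : ℝ) • gradient χ y)
      ((volume : Measure (ℝ × EuclideanSpace ℝ (Fin 3))).restrict S) := by
  have hc : Continuous (gradient χ) := (contDiff_gradient_of_contDiff_top hχ.contDiff).continuous
  exact ((hc.comp continuous_snd).const_smul (2 : ℝ)).aestronglyMeasurable

/-- **A common bound** `M ≥ 0` for `v`, `ũ` and `2∇χ` on the slab `(s₀, t) × ℝ³`. [folklore] -/
theorem exists_slab_bound :
    ∃ M : ℝ, 0 ≤ M ∧ (∀ τ ∈ Ioo s₀ t, ∀ y, ‖locVelocity χ u τ y‖ ≤ M) ∧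
      (∀ τ ∈ Ioo s₀ t, ∀ y, ‖locExtension x₁ R u τ y‖ ≤ M) ∧
      ∀ τ ∈ Ioo s₀ t, ∀ y : EuclideanSpace ℝ (Fin 3), ‖(2 : ℝ) • gradient χ y‖ ≤ M := by
  obtain ⟨M₁, h1, hM₁⟩ := exists_forall_norm_locVelocity_le hsol hχ hI
  obtain ⟨M₂, h2, hM₂⟩ := exists_forall_norm_locExtension_le hsol hI
  have hgc : Continuous fun y => (2 : ℝ) • gradient χ y := by
    exact ((contDiff_gradient_of_contDiff_top hχ.contDiff).continuous).const_smul (2 : ℝ)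
  have hgs : HasCompactSupport fun y => (2 : ℝ) • gradient χ y := by
    refine hχ.hasCompactSupport.mono' fun y hy => ?_
    by_contra h
    exact hy (by simp [gradient_eq_zero_of_notMem_tsupport h])
  obtain ⟨M₃, hM₃⟩ := hgc.norm.bddAbove_range_of_hasCompactSupport hgs.norm
  refine ⟨max (max M₁ M₂) (max M₃ 0), le_max_of_le_right (le_max_right _ _), fun τ hτ y => ?_,
    fun τ hτ y => ?_, fun τ _ y => ?_⟩
  · exact (hM₁ τ (Ioo_subset_Icc_self hτ) y).trans ((le_max_left _ _).trans (le_max_left _ _))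
  · exact (hM₂ τ (Ioo_subset_Icc_self hτ) y).trans ((le_max_right _ _).trans (le_max_left _ _))
  · exact (hM₃ (mem_range_self y)).trans ((le_max_left _ _).trans (le_max_right _ _))

end Slab

/-! ### Pairings of the individual terms with solenoidal test fields -/

section Pairings

variable (hsol : IsCylinderSolution x₁ δ R u p) (hχ : IsLocCutoff x₁ R χ)
include hsol hχ

/-- **`∫ ⟪P[v(t)], φ⟫ = ∫ ⟪v(t), φ⟫`** for divergence-free tests `φ`. [folklore] -/
theorem integral_inner_locSolPart_eq {t : ℝ} (ht : t ∈ Ioo (-δ) (R ^ 2))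
    {φ : EuclideanSpace ℝ (Fin 3) → EuclideanSpace ℝ (Fin 3)}
    (hφ : FunctionSpaces.IsTestFunctionOn (⊤ : TopologicalSpace.Opens (EuclideanSpace ℝ (Fin 3))) φ)
    (hdiv : VectorCalculus.IsDivFree φ) :
    ∫ x, ⟪locSolPart χ u t x, φ x⟫ = ∫ x, ⟪locVelocity χ u t x, φ x⟫ := by
  have h := integral_inner_classicalLerayProj_heatFlow (contDiff_locVelocity hsol hχ ht)
    (hasCompactSupport_locVelocity hχ) hφ hdiv 0
  simp only [heatFlow_of_nonpos _ le_rfl] at h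
  simpa [locSolPart_eq] using h

/-- **Pairing of the heat datum**: for `s₀ < t`,
`∫ ⟪e^{(t-s₀)Δ}P[v(s₀)], φ⟫ = ∫ ⟪v(s₀), e^{(t-s₀)Δ}φ⟫` (symmetry of the heat semigroup on the
bounded continuous datum, then `P` is self-adjoint against solenoidal caloric tests). [folklore] -/
theorem integral_inner_locDatum_eq {s₀ t : ℝ} (hs₀ : s₀ ∈ Ioo (-δ) (R ^ 2)) (hst : s₀ < t)
    {φ : EuclideanSpace ℝ (Fin 3) → EuclideanSpace ℝ (Fin 3)}
    (hφ : FunctionSpaces.IsTestFunctionOn (⊤ : TopologicalSpace.Opens (EuclideanSpace ℝ (Fin 3))) φ)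
    (hdiv : VectorCalculus.IsDivFree φ) :
    ∫ x, ⟪locDatum χ u s₀ t x, φ x⟫ = ∫ x, ⟪locVelocity χ u s₀ x, heatTest 1 φ (t - s₀) x⟫ := by
  have hσ : 0 < t - s₀ := sub_pos.2 hst
  have ha : ContDiff ℝ ∞ (locSolPart χ u s₀) := contDiff_locSolPart hsol hχ hs₀
  -- a bound for the datum `P[v(s₀)]`
  obtain ⟨Cv, hCv⟩ := (contDiff_locVelocity hsol hχ hs₀).continuous.norm.bddAbove_range_of_hasCompactSupport
    (hasCompactSupport_locVelocity hχ).norm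
  obtain ⟨Cg, hCg⟩ := exists_forall_norm_gradient_divPotential_le (contDiff_locVelocity hsol hχ hs₀)
    (hasCompactSupport_locVelocity hχ (u := u) (t := s₀))
  have hbd : ∀ y, ‖locSolPart χ u s₀ y‖ ≤ Cv + Cg := fun y => by
    rw [locSolPart_eq, classicalLerayProj_apply]
    exact (norm_sub_le _ _).trans (add_le_add (hCv (mem_range_self y)) (hCg y))
  rw [show locDatum χ u s₀ t = heatFlow (locSolPart χ u s₀) (t - s₀) from rfl, heatFlow_of_pos _ hσ,
    integral_inner_heatExtension_comm_of_bound ha.continuous.aestronglyMeasurable hbd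
      hφ.contDiff.continuous hφ.hasCompactSupport hσ]
  have e : ∀ x, UnboundedOperators.heatExtension φ (t - s₀) x = heatFlow φ (t - s₀) x := fun x => by
    rw [heatFlow_of_pos _ hσ]
  simp_rw [e, locSolPart_eq]
  rw [integral_inner_classicalLerayProj_heatFlow (contDiff_locVelocity hsol hχ hs₀)
    (hasCompactSupport_locVelocity hχ) hφ hdiv]
  simp [heatTest, one_mul]

end Pairings

/-- **Pairing of a Duhamel term** `B¹_{s₀}(w, ũ)(t)` of bounded slab fields with a divergence-free
test: `∫ ⟪B¹_{s₀}(w,ũ)(t), φ⟫ = -∫_{(s₀,t)} ∫ ⟪ũ, D(e^{(t-τ)Δ}φ)(w)⟫ dτ`, with the caloric test written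
as `heatTest 1 φ (t - τ)`. [cite: LemarieRieusset2016, Thm. 6.1 ((6.11)–(6.12))] -/
theorem integral_inner_oseenDuhamel_eq_heatTest
    {w ũ : ℝ → EuclideanSpace ℝ (Fin 3) → EuclideanSpace ℝ (Fin 3)} {s₀ t M : ℝ}
    (hw : AEStronglyMeasurable (uncurry w)
      ((volume : Measure (ℝ × EuclideanSpace ℝ (Fin 3))).restrict (Ioo s₀ t ×ˢ univ)))
    (hũ : AEStronglyMeasurable (uncurry ũ)
      ((volume : Measure (ℝ × EuclideanSpace ℝ (Fin 3))).restrict (Ioo s₀ t ×ˢ univ)))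
    (hM : 0 ≤ M) (hwM : ∀ τ ∈ Ioo s₀ t, ∀ y, ‖w τ y‖ ≤ M) (hũM : ∀ τ ∈ Ioo s₀ t, ∀ y, ‖ũ τ y‖ ≤ M)
    (hst : s₀ < t) {φ : EuclideanSpace ℝ (Fin 3) → EuclideanSpace ℝ (Fin 3)}
    (hφ : FunctionSpaces.IsTestFunctionOn (⊤ : TopologicalSpace.Opens (EuclideanSpace ℝ (Fin 3))) φ)
    (hdiv : VectorCalculus.IsDivFree φ) :
    ∫ x, ⟪oseenDuhamel 1 s₀ w ũ t x, φ x⟫ =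
      -∫ τ in Ioo s₀ t, ∫ y, ⟪ũ τ y, fderiv ℝ (heatTest 1 φ (t - τ)) y (w τ y)⟫ := by
  rw [(integral_inner_oseenDuhamel_of_isDivFree one_pos hw hũ hM hwM hũM hst le_rfl hφ hdiv).2]
  congr 1
  refine setIntegral_congr_fun measurableSet_Ioo fun τ hτ => ?_
  have hσ : 0 < t - τ := sub_pos.2 hτ.2
  have e : heatTest 1 φ (t - τ) = UnboundedOperators.heatExtension φ (1 * (t - τ)) := by
    funext y
    rw [heatTest, heatFlow_of_pos _ (by rwa [one_mul])]
  simp only [e]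

/-! ### Regularity and bounds of the individual terms -/

section Terms

variable (hsol : IsCylinderSolution x₁ δ R u p) (hχ : IsLocCutoff x₁ R χ)
include hsol hχ

/-- `P[v(t)]` is bounded. [folklore] -/
theorem exists_forall_norm_locSolPart_le {t : ℝ} (ht : t ∈ Ioo (-δ) (R ^ 2)) :
    ∃ C : ℝ, ∀ y, ‖locSolPart χ u t y‖ ≤ C := by
  obtain ⟨Cv, hCv⟩ := (contDiff_locVelocity hsol hχ ht).continuous.norm.bddAbove_range_of_hasCompactSupport
    (hasCompactSupport_locVelocity hχ).norm
  obtain ⟨Cg, hCg⟩ := exists_forall_norm_gradient_divPotential_le (contDiff_locVelocity hsol hχ ht)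
    (hasCompactSupport_locVelocity hχ (u := u) (t := t))
  refine ⟨Cv + Cg, fun y => ?_⟩
  rw [locSolPart_eq, classicalLerayProj_apply]
  exact (norm_sub_le _ _).trans (add_le_add (hCv (mem_range_self y)) (hCg y))

/-- `P[v(t)]` is weakly divergence free. [folklore] -/
theorem isWeaklyDivFree_locSolPart {t : ℝ} (ht : t ∈ Ioo (-δ) (R ^ 2)) :
    IsWeaklyDivFree (locSolPart χ u t) :=
  VectorCalculus.IsDivFree.isWeaklyDivFree_holds (isDivFree_locSolPart hsol hχ ht)
    ((contDiff_locSolPart hsol hχ ht).of_le (by norm_cast))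

/-- The heat datum `e^{(t-s₀)Δ}P[v(s₀)]` is continuous, bounded by any bound of `P[v(s₀)]`, and
weakly divergence free. [folklore] -/
theorem locDatum_regular {s₀ : ℝ} (hs₀ : s₀ ∈ Ioo (-δ) (R ^ 2)) {C : ℝ}
    (hC : ∀ y, ‖locSolPart χ u s₀ y‖ ≤ C) (t : ℝ) :
    Continuous (locDatum χ u s₀ t) ∧ (∀ y, ‖locDatum χ u s₀ t y‖ ≤ C) ∧
      IsWeaklyDivFree (locDatum χ u s₀ t) := by
  have ha : Continuous (locSolPart χ u s₀) := (contDiff_locSolPart hsol hχ hs₀).continuous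
  have hD : locDatum χ u s₀ t = heatFlow (locSolPart χ u s₀) (t - s₀) := rfl
  refine ⟨?_, fun y => norm_heatFlow_le hC _ _, ?_⟩
  · rw [hD]
    exact (continuous_uncurry_heatFlow ha hC).comp (Continuous.prodMk_right (t - s₀))
  · rcases le_or_gt (t - s₀) 0 with hσ | hσ
    · rw [hD, heatFlow_of_nonpos _ hσ]
      exact isWeaklyDivFree_locSolPart hsol hχ hs₀
    · rw [hD, heatFlow_of_pos _ hσ]
      exact (isWeaklyDivFree_locSolPart hsol hχ hs₀).heatExtension_of_bound ha.aestronglyMeasurable hC hσ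

end Terms

/-! ### The residual annihilates solenoidal tests -/

section Residual

variable (hsol : IsCylinderSolution x₁ δ R u p) (hχ : IsLocCutoff x₁ R χ) {s₀ t : ℝ}
  (hs₀ : -δ < s₀) (hst : s₀ < t) (htR : t < R ^ 2)
include hsol hχ hs₀ hst htR

/-- **The residual of the representation annihilates every smooth compactly supported
divergence-free field.** [cite: LemarieRieusset2016, Thm. 6.1] -/
theorem integral_inner_residual_eq_zero
    {φ : EuclideanSpace ℝ (Fin 3) → EuclideanSpace ℝ (Fin 3)}
    (hφ : FunctionSpaces.IsTestFunctionOn (⊤ : TopologicalSpace.Opens (EuclideanSpace ℝ (Fin 3))) φ)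
    (hdiv : VectorCalculus.IsDivFree φ) :
    ∫ x, ⟪locSolPart χ u t x - locDatum χ u s₀ t x
        + oseenDuhamel 1 s₀ (locVelocity χ u) (locExtension x₁ R u) t x
        + oseenDuhamel 1 s₀ (fun _ y => (2 : ℝ) • gradient χ y) (locExtension x₁ R u) t x
        - locForcing χ u p s₀ t x, φ x⟫ = 0 := by
  have hI : Icc s₀ t ⊆ Ioo (-δ) (R ^ 2) := fun s hs => ⟨hs₀.trans_le hs.1, hs.2.trans_lt htR⟩
  have hs₀S : s₀ ∈ Ioo (-δ) (R ^ 2) := hI (left_mem_Icc.2 hst.le)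
  have htS : t ∈ Ioo (-δ) (R ^ 2) := hI (right_mem_Icc.2 hst.le)
  have htI : t ∈ Icc s₀ t := right_mem_Icc.2 hst.le
  obtain ⟨M, hM0, hvM, hũM, hgM⟩ := exists_slab_bound hsol hχ hI
  have hvm := aestronglyMeasurable_uncurry_locVelocity hsol hχ hI
  have hũm := aestronglyMeasurable_uncurry_locExtension hsol hI
  have hgm := aestronglyMeasurable_uncurry_gradCutoff hχ (Ioo s₀ t ×ˢ (univ : Set (EuclideanSpace ℝ (Fin 3))))
  have hφi : Integrable φ := hφ.contDiff.continuous.integrable_of_hasCompactSupport hφ.hasCompactSupport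
  -- the five terms: measurability and bounds, hence integrability of the pairings
  obtain ⟨CA, hCA⟩ := exists_forall_norm_locSolPart_le hsol hχ htS
  obtain ⟨CA₀, hCA₀⟩ := exists_forall_norm_locSolPart_le hsol hχ hs₀S
  obtain ⟨hDc, hDb, -⟩ := locDatum_regular hsol hχ hs₀S hCA₀ t
  obtain ⟨CB, -, hCB⟩ := exists_norm_oseenDuhamel_bounded_le (E := EuclideanSpace ℝ (Fin 3))
  obtain ⟨CF, -, hCF⟩ := exists_norm_locForcing_le hsol hχ hI
  have iA : Integrable fun x => ⟪locSolPart χ u t x, φ x⟫ :=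
    integrable_inner_of_aestronglyMeasurable_of_norm_le
      (contDiff_locSolPart hsol hχ htS).continuous.aestronglyMeasurable hCA hφi
  have iD : Integrable fun x => ⟪locDatum χ u s₀ t x, φ x⟫ :=
    integrable_inner_of_aestronglyMeasurable_of_norm_le hDc.aestronglyMeasurable hDb hφi
  have iB₁ : Integrable fun x => ⟪oseenDuhamel 1 s₀ (locVelocity χ u) (locExtension x₁ R u) t x, φ x⟫ :=
    integrable_inner_of_aestronglyMeasurable_of_norm_le
      (aestronglyMeasurable_oseenDuhamel one_pos hvm hũm hM0 hvM hũM hst le_rfl)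
      (fun x => hCB one_pos hst hM0 hvM hũM x) hφi
  have iB₂ : Integrable fun x =>
      ⟪oseenDuhamel 1 s₀ (fun _ y => (2 : ℝ) • gradient χ y) (locExtension x₁ R u) t x, φ x⟫ :=
    integrable_inner_of_aestronglyMeasurable_of_norm_le
      (aestronglyMeasurable_oseenDuhamel one_pos hgm hũm hM0 hgM hũM hst le_rfl)
      (fun x => hCB one_pos hst hM0 hgM hũM x) hφi
  have iF : Integrable fun x => ⟪locForcing χ u p s₀ t x, φ x⟫ :=
    integrable_inner_of_aestronglyMeasurable_of_norm_le
      (continuous_locForcing hsol hχ hI htI).aestronglyMeasurable (fun x => hCF t htI x) hφi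
  -- split the pairing
  have hsplit : ∫ x, ⟪locSolPart χ u t x - locDatum χ u s₀ t x
        + oseenDuhamel 1 s₀ (locVelocity χ u) (locExtension x₁ R u) t x
        + oseenDuhamel 1 s₀ (fun _ y => (2 : ℝ) • gradient χ y) (locExtension x₁ R u) t x
        - locForcing χ u p s₀ t x, φ x⟫ =
      (∫ x, ⟪locSolPart χ u t x, φ x⟫) - (∫ x, ⟪locDatum χ u s₀ t x, φ x⟫)
        + (∫ x, ⟪oseenDuhamel 1 s₀ (locVelocity χ u) (locExtension x₁ R u) t x, φ x⟫)
        + (∫ x, ⟪oseenDuhamel 1 s₀ (fun _ y => (2 : ℝ) • gradient χ y) (locExtension x₁ R u) t x, φ x⟫)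
        - ∫ x, ⟪locForcing χ u p s₀ t x, φ x⟫ := by
    simp only [inner_sub_left, inner_add_left]
    have i2 : Integrable fun x => ⟪locSolPart χ u t x, φ x⟫ - ⟪locDatum χ u s₀ t x, φ x⟫ := iA.sub iD
    have i3 : Integrable fun x => ⟪locSolPart χ u t x, φ x⟫ - ⟪locDatum χ u s₀ t x, φ x⟫
        + ⟪oseenDuhamel 1 s₀ (locVelocity χ u) (locExtension x₁ R u) t x, φ x⟫ := i2.add iB₁
    have i4 : Integrable fun x => ⟪locSolPart χ u t x, φ x⟫ - ⟪locDatum χ u s₀ t x, φ x⟫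
        + ⟪oseenDuhamel 1 s₀ (locVelocity χ u) (locExtension x₁ R u) t x, φ x⟫
        + ⟪oseenDuhamel 1 s₀ (fun _ y => (2 : ℝ) • gradient χ y) (locExtension x₁ R u) t x, φ x⟫ :=
      i3.add iB₂
    rw [integral_sub i4 iF, integral_add i3 iB₂, integral_add i2 iB₁, integral_sub iA iD]
  -- the pairing identities
  have pA := integral_inner_locSolPart_eq hsol hχ htS hφ hdiv
  have pD := integral_inner_locDatum_eq hsol hχ hs₀S hst hφ hdiv
  have pB₁ := integral_inner_oseenDuhamel_eq_heatTest hvm hũm hM0 hvM hũM hst hφ hdiv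
  have pB₂ := integral_inner_oseenDuhamel_eq_heatTest hgm hũm hM0 hgM hũM hst hφ hdiv
  have pF := integral_inner_locForcing_eq hsol hχ hI htI hφ hdiv
  have pV := integral_inner_locVelocity_eq_duality hsol hχ hφ hdiv hs₀ hst.le htR
  -- integrability of the three time integrands of the duality identity on `(s₀, t)`
  have hprod : ((volume : Measure (ℝ × EuclideanSpace ℝ (Fin 3))).restrict (Ioo s₀ t ×ˢ univ)) =
      ((volume : Measure ℝ).restrict (Ioo s₀ t)).prod (volume : Measure (EuclideanSpace ℝ (Fin 3))) :=
    volume_restrict_prod_univ_eq_prod _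
  have hcongrT : ∀ τ ∈ Ioo s₀ t, heatTest 1 φ (t - τ) =
      UnboundedOperators.heatExtension φ (1 * (t - τ)) := fun τ hτ => by
    funext y
    rw [heatTest, heatFlow_of_pos _ (by rw [one_mul]; exact sub_pos.2 hτ.2)]
  have k₂i : IntegrableOn (fun τ => ∫ y, ⟪locExtension x₁ R u τ y,
      fderiv ℝ (heatTest 1 φ (t - τ)) y (locVelocity χ u τ y)⟫) (Ioo s₀ t) := by
    have h := (integral_inner_oseenDuhamel_of_isDivFree one_pos hvm hũm hM0 hvM hũM hst le_rfl
      hφ hdiv).1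
    rw [hprod] at h
    have h' : IntegrableOn (fun τ => ∫ y, ⟪locExtension x₁ R u τ y,
        fderiv ℝ (UnboundedOperators.heatExtension φ (1 * (t - τ))) y (locVelocity χ u τ y)⟫)
        (Ioo s₀ t) := h.integral_prod_left
    exact h'.congr_fun (fun τ hτ => by simp only [hcongrT τ hτ]) measurableSet_Ioo
  have k₃i : IntegrableOn (fun τ => ∫ y, ⟪locExtension x₁ R u τ y,
      fderiv ℝ (heatTest 1 φ (t - τ)) y ((2 : ℝ) • gradient χ y)⟫) (Ioo s₀ t) := by
    have h := (integral_inner_oseenDuhamel_of_isDivFree one_pos hgm hũm hM0 hgM hũM hst le_rfl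
      hφ hdiv).1
    rw [hprod] at h
    have h' : IntegrableOn (fun τ => ∫ y, ⟪locExtension x₁ R u τ y,
        fderiv ℝ (UnboundedOperators.heatExtension φ (1 * (t - τ))) y ((2 : ℝ) • gradient χ y)⟫)
        (Ioo s₀ t) := h.integral_prod_left
    exact h'.congr_fun (fun τ hτ => by simp only [hcongrT τ hτ]) measurableSet_Ioo
  have k₁i : IntegrableOn (fun τ => ∫ y, ⟪locForce χ u p τ y, heatTest 1 φ (t - τ) y⟫) (Ioo s₀ t) := by
    -- continuous on `[s₀, t]`: jointly continuous integrand with fixed compact `y`-support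
    obtain ⟨Cφ, hCφ⟩ := hφ.contDiff.continuous.norm.bddAbove_range_of_hasCompactSupport
      hφ.hasCompactSupport.norm
    have hheat : Continuous (uncurry (heatFlow φ)) :=
      continuous_uncurry_heatFlow hφ.contDiff.continuous fun z => hCφ (mem_range_self z)
    have hT : ContinuousOn (uncurry fun τ y => heatTest 1 φ (t - τ) y) (Icc s₀ t ×ˢ univ) := by
      have hmap : Continuous fun q : ℝ × EuclideanSpace ℝ (Fin 3) => ((1 * (t - q.1), q.2) : ℝ × _) := by
        fun_prop
      exact ((hheat.comp hmap).continuousOn).congr fun q _ => rfl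
    have hk : ContinuousOn (uncurry fun τ y => ⟪locForce χ u p τ y, heatTest 1 φ (t - τ) y⟫)
        (Icc s₀ t ×ˢ univ) :=
      ((isSmoothSpaceTimeOn_locForce hsol hχ).continuousOn.mono (prod_mono hI subset_rfl)).inner hT
    have hc := continuousOn_integral_of_support_subset (μ := (volume : Measure (EuclideanSpace ℝ (Fin 3))))
      (isCompact_closedBall x₁ (R - 3)) hk fun τ _ y hy => by
        have : y ∉ tsupport (locForce χ u p τ) := fun h => hy (tsupport_locForce_subset hχ h)
        simp [image_eq_zero_of_notMem_tsupport this]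
    exact (hc.integrableOn_Icc).mono_set Ioo_subset_Icc_self
  -- assemble
  have k12 : IntegrableOn (fun τ => (∫ y, ⟪locForce χ u p τ y, heatTest 1 φ (t - τ) y⟫)
      + ∫ y, ⟪locExtension x₁ R u τ y, fderiv ℝ (heatTest 1 φ (t - τ)) y (locVelocity χ u τ y)⟫)
      (Ioo s₀ t) := k₁i.add k₂i
  rw [hsplit, pA, pD, pB₁, pB₂, pF, pV, integral_add k12 k₃i, integral_add k₁i k₂i]
  ring

/-- **The residual is weakly divergence free.** [folklore] -/
theorem isWeaklyDivFree_residual :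
    IsWeaklyDivFree fun x => locSolPart χ u t x - locDatum χ u s₀ t x
        + oseenDuhamel 1 s₀ (locVelocity χ u) (locExtension x₁ R u) t x
        + oseenDuhamel 1 s₀ (fun _ y => (2 : ℝ) • gradient χ y) (locExtension x₁ R u) t x
        - locForcing χ u p s₀ t x := by
  have hI : Icc s₀ t ⊆ Ioo (-δ) (R ^ 2) := fun s hs => ⟨hs₀.trans_le hs.1, hs.2.trans_lt htR⟩
  have hs₀S : s₀ ∈ Ioo (-δ) (R ^ 2) := hI (left_mem_Icc.2 hst.le)
  have htS : t ∈ Ioo (-δ) (R ^ 2) := hI (right_mem_Icc.2 hst.le)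
  have htI : t ∈ Icc s₀ t := right_mem_Icc.2 hst.le
  obtain ⟨M, hM0, hvM, hũM, hgM⟩ := exists_slab_bound hsol hχ hI
  have hvm := aestronglyMeasurable_uncurry_locVelocity hsol hχ hI
  have hũm := aestronglyMeasurable_uncurry_locExtension hsol hI
  have hgm := aestronglyMeasurable_uncurry_gradCutoff hχ (Ioo s₀ t ×ˢ (univ : Set (EuclideanSpace ℝ (Fin 3))))
  obtain ⟨CA, hCA⟩ := exists_forall_norm_locSolPart_le hsol hχ htS
  obtain ⟨CA₀, hCA₀⟩ := exists_forall_norm_locSolPart_le hsol hχ hs₀S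
  obtain ⟨hDc, hDb, hDd⟩ := locDatum_regular hsol hχ hs₀S hCA₀ t
  obtain ⟨CB, -, hCB⟩ := exists_norm_oseenDuhamel_bounded_le (E := EuclideanSpace ℝ (Fin 3))
  obtain ⟨CF, -, hCF⟩ := exists_norm_locForcing_le hsol hχ hI
  intro θ hθ
  have hθ1 : ContDiff ℝ 1 θ := hθ.contDiff.of_le (by norm_cast)
  have hgi : Integrable (gradient θ) :=
    (continuous_gradient_of_contDiff hθ1).integrable_of_hasCompactSupport
      (hθ.hasCompactSupport.mono' fun x hx => by
        by_contra h; exact hx (gradient_eq_zero_of_notMem_tsupport h))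
  have iA : Integrable fun x => ⟪locSolPart χ u t x, gradient θ x⟫ :=
    integrable_inner_of_aestronglyMeasurable_of_norm_le
      (contDiff_locSolPart hsol hχ htS).continuous.aestronglyMeasurable hCA hgi
  have iD : Integrable fun x => ⟪locDatum χ u s₀ t x, gradient θ x⟫ :=
    integrable_inner_of_aestronglyMeasurable_of_norm_le hDc.aestronglyMeasurable hDb hgi
  have iB₁ : Integrable fun x =>
      ⟪oseenDuhamel 1 s₀ (locVelocity χ u) (locExtension x₁ R u) t x, gradient θ x⟫ :=
    integrable_inner_of_aestronglyMeasurable_of_norm_le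
      (aestronglyMeasurable_oseenDuhamel one_pos hvm hũm hM0 hvM hũM hst le_rfl)
      (fun x => hCB one_pos hst hM0 hvM hũM x) hgi
  have iB₂ : Integrable fun x =>
      ⟪oseenDuhamel 1 s₀ (fun _ y => (2 : ℝ) • gradient χ y) (locExtension x₁ R u) t x, gradient θ x⟫ :=
    integrable_inner_of_aestronglyMeasurable_of_norm_le
      (aestronglyMeasurable_oseenDuhamel one_pos hgm hũm hM0 hgM hũM hst le_rfl)
      (fun x => hCB one_pos hst hM0 hgM hũM x) hgi
  have iF : Integrable fun x => ⟪locForcing χ u p s₀ t x, gradient θ x⟫ :=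
    integrable_inner_of_aestronglyMeasurable_of_norm_le
      (continuous_locForcing hsol hχ hI htI).aestronglyMeasurable (fun x => hCF t htI x) hgi
  have zA := isWeaklyDivFree_locSolPart hsol hχ htS θ hθ
  have zD := hDd θ hθ
  have zB₁ := isWeaklyDivFree_oseenDuhamel one_pos hvm hũm hM0 hvM hũM hst le_rfl θ hθ
  have zB₂ := isWeaklyDivFree_oseenDuhamel one_pos hgm hũm hM0 hgM hũM hst le_rfl θ hθ
  have zF := isWeaklyDivFree_locForcing hsol hχ hI htI θ hθ
  have i2 : Integrable fun x => ⟪locSolPart χ u t x, gradient θ x⟫ - ⟪locDatum χ u s₀ t x, gradient θ x⟫ :=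
    iA.sub iD
  have i3 : Integrable fun x => ⟪locSolPart χ u t x, gradient θ x⟫ - ⟪locDatum χ u s₀ t x, gradient θ x⟫
      + ⟪oseenDuhamel 1 s₀ (locVelocity χ u) (locExtension x₁ R u) t x, gradient θ x⟫ := i2.add iB₁
  have i4 : Integrable fun x => ⟪locSolPart χ u t x, gradient θ x⟫ - ⟪locDatum χ u s₀ t x, gradient θ x⟫
      + ⟪oseenDuhamel 1 s₀ (locVelocity χ u) (locExtension x₁ R u) t x, gradient θ x⟫
      + ⟪oseenDuhamel 1 s₀ (fun _ y => (2 : ℝ) • gradient χ y) (locExtension x₁ R u) t x, gradient θ x⟫ :=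
    i3.add iB₂
  show ∫ x, ⟪locSolPart χ u t x - locDatum χ u s₀ t x
        + oseenDuhamel 1 s₀ (locVelocity χ u) (locExtension x₁ R u) t x
        + oseenDuhamel 1 s₀ (fun _ y => (2 : ℝ) • gradient χ y) (locExtension x₁ R u) t x
        - locForcing χ u p s₀ t x, gradient θ x⟫ = 0
  simp only [inner_sub_left, inner_add_left]
  rw [integral_sub i4 iF, integral_add i3 iB₂, integral_add i2 iB₁, integral_sub iA iD, zA, zD, zB₁,
    zB₂, zF]
  ring

/-- **The residual is a.e. equal to a constant.** [cite: LemarieRieusset2016, §6.3 (proof of Thm. 6.1)] -/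
theorem exists_residual_ae_eq_const :
    ∃ c : EuclideanSpace ℝ (Fin 3), (fun x => locSolPart χ u t x - locDatum χ u s₀ t x
        + oseenDuhamel 1 s₀ (locVelocity χ u) (locExtension x₁ R u) t x
        + oseenDuhamel 1 s₀ (fun _ y => (2 : ℝ) • gradient χ y) (locExtension x₁ R u) t x
        - locForcing χ u p s₀ t x) =ᵐ[volume] fun _ => c := by
  have hI : Icc s₀ t ⊆ Ioo (-δ) (R ^ 2) := fun s hs => ⟨hs₀.trans_le hs.1, hs.2.trans_lt htR⟩
  have hs₀S : s₀ ∈ Ioo (-δ) (R ^ 2) := hI (left_mem_Icc.2 hst.le)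
  have htS : t ∈ Ioo (-δ) (R ^ 2) := hI (right_mem_Icc.2 hst.le)
  have htI : t ∈ Icc s₀ t := right_mem_Icc.2 hst.le
  obtain ⟨M, hM0, hvM, hũM, hgM⟩ := exists_slab_bound hsol hχ hI
  have hvm := aestronglyMeasurable_uncurry_locVelocity hsol hχ hI
  have hũm := aestronglyMeasurable_uncurry_locExtension hsol hI
  have hgm := aestronglyMeasurable_uncurry_gradCutoff hχ (Ioo s₀ t ×ˢ (univ : Set (EuclideanSpace ℝ (Fin 3))))
  obtain ⟨CA, hCA⟩ := exists_forall_norm_locSolPart_le hsol hχ htS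
  obtain ⟨CA₀, hCA₀⟩ := exists_forall_norm_locSolPart_le hsol hχ hs₀S
  obtain ⟨hDc, hDb, -⟩ := locDatum_regular hsol hχ hs₀S hCA₀ t
  obtain ⟨CB, -, hCB⟩ := exists_norm_oseenDuhamel_bounded_le (E := EuclideanSpace ℝ (Fin 3))
  obtain ⟨CF, -, hCF⟩ := exists_norm_locForcing_le hsol hχ hI
  have hmeas : AEStronglyMeasurable (fun x => locSolPart χ u t x - locDatum χ u s₀ t x
        + oseenDuhamel 1 s₀ (locVelocity χ u) (locExtension x₁ R u) t x
        + oseenDuhamel 1 s₀ (fun _ y => (2 : ℝ) • gradient χ y) (locExtension x₁ R u) t x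
        - locForcing χ u p s₀ t x) volume :=
    ((((contDiff_locSolPart hsol hχ htS).continuous.aestronglyMeasurable.sub hDc.aestronglyMeasurable).add
      (aestronglyMeasurable_oseenDuhamel one_pos hvm hũm hM0 hvM hũM hst le_rfl)).add
      (aestronglyMeasurable_oseenDuhamel one_pos hgm hũm hM0 hgM hũM hst le_rfl)).sub
      (continuous_locForcing hsol hχ hI htI).aestronglyMeasurable
  set K : ℝ := CB * M ^ 2 * (1 : ℝ) ^ (-(1 / 2 : ℝ)) * (2 * Real.sqrt (t - s₀)) with hK
  have hbd : ∀ x, ‖locSolPart χ u t x - locDatum χ u s₀ t x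
        + oseenDuhamel 1 s₀ (locVelocity χ u) (locExtension x₁ R u) t x
        + oseenDuhamel 1 s₀ (fun _ y => (2 : ℝ) • gradient χ y) (locExtension x₁ R u) t x
        - locForcing χ u p s₀ t x‖ ≤ CA + CA₀ + K + K + CF * (t - s₀) := fun x =>
    calc _ ≤ ‖locSolPart χ u t x - locDatum χ u s₀ t x
          + oseenDuhamel 1 s₀ (locVelocity χ u) (locExtension x₁ R u) t x
          + oseenDuhamel 1 s₀ (fun _ y => (2 : ℝ) • gradient χ y) (locExtension x₁ R u) t x‖
          + ‖locForcing χ u p s₀ t x‖ := norm_sub_le _ _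
      _ ≤ (‖locSolPart χ u t x - locDatum χ u s₀ t x
          + oseenDuhamel 1 s₀ (locVelocity χ u) (locExtension x₁ R u) t x‖
          + ‖oseenDuhamel 1 s₀ (fun _ y => (2 : ℝ) • gradient χ y) (locExtension x₁ R u) t x‖)
          + CF * (t - s₀) := add_le_add (norm_add_le _ _) (hCF t htI x)
      _ ≤ ((‖locSolPart χ u t x - locDatum χ u s₀ t x‖
          + ‖oseenDuhamel 1 s₀ (locVelocity χ u) (locExtension x₁ R u) t x‖) + K) + CF * (t - s₀) := by
          gcongr
          · exact norm_add_le _ _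
          · exact hCB one_pos hst hM0 hgM hũM x
      _ ≤ (((CA + CA₀) + K) + K) + CF * (t - s₀) := by
          gcongr
          · exact (norm_sub_le _ _).trans (add_le_add (hCA x) (hDb x))
          · exact hCB one_pos hst hM0 hvM hũM x
      _ = CA + CA₀ + K + K + CF * (t - s₀) := by ring
  exact (isWeaklyDivFree_residual hsol hχ hs₀ hst htR).exists_ae_eq_const_of_norm_le_of_forall_integral_inner_eq_zero
    hmeas hbd fun φ hφ hdiv => integral_inner_residual_eq_zero hsol hχ hs₀ hst htR hφ hdiv

end Residual

/-! ### The constant vanishes: heat flow at infinity -/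

section Vanishing

variable (hsol : IsCylinderSolution x₁ δ R u p) (hχ : IsLocCutoff x₁ R χ) {s₀ t : ℝ}
  (hs₀ : -δ < s₀) (hst : s₀ < t) (htR : t < R ^ 2)
include hsol hχ hs₀ hst htR

omit hs₀ hst htR in
/-- **Heat flow of the Leray–Helmholtz solenoidal part at the origin tends to zero**:
`‖e^{σΔ}P[v(s)](0)‖ → 0` as `σ → ∞` along any `σ = a + τ`, `τ → ∞` (`v(s) ∈ L²`, and
`e^{σΔ}∇π = ∇e^{σΔ}π = O(σ^{-1/2})`). [folklore] -/
theorem tendsto_norm_heatExtension_locSolPart {s : ℝ} (hs : s ∈ Ioo (-δ) (R ^ 2)) (a : ℝ) :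
    Tendsto (fun τ : ℝ => ‖UnboundedOperators.heatExtension (locSolPart χ u s) (a + τ) 0‖) atTop (𝓝 0) := by
  have hE : 0 < Module.finrank ℝ (EuclideanSpace ℝ (Fin 3)) := Module.finrank_pos
  have hv : ContDiff ℝ ∞ (locVelocity χ u s) := contDiff_locVelocity hsol hχ hs
  have hvc := hasCompactSupport_locVelocity hχ (u := u) (t := s)
  have hπ1 : ContDiff ℝ 1 (locPotential χ u s) := (contDiff_locPotential hsol hχ hs).of_le (by norm_cast)
  have hg : Continuous (gradient (locPotential χ u s)) := continuous_gradient_of_contDiff hπ1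
  obtain ⟨Cv, hCv⟩ := hv.continuous.norm.bddAbove_range_of_hasCompactSupport hvc.norm
  obtain ⟨Cg, hCg⟩ := exists_forall_norm_gradient_divPotential_le hv hvc
  obtain ⟨Cπ, hCπ⟩ := exists_forall_abs_divPotential_le hv hvc
  have h2 : MemLp (locVelocity χ u s) 2 (volume : Measure (EuclideanSpace ℝ (Fin 3))) :=
    hv.continuous.memLp_of_hasCompactSupport hvc
  set D : ℝ := (2 : ℝ) ^ ((Module.finrank ℝ (EuclideanSpace ℝ (Fin 3)) : ℝ) / 2) with hD
  -- the two pieces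
  have lim_v : Tendsto (fun τ : ℝ => ‖UnboundedOperators.heatExtension (locVelocity χ u s) (a + τ) 0‖)
      atTop (𝓝 0) := by
    have h1 := UnboundedOperators.tendsto_enorm_heatExtension_atTop h2 (by norm_num) (by norm_num) hE
      (0 : EuclideanSpace ℝ (Fin 3))
    have h2' := (ENNReal.tendsto_toReal ENNReal.zero_ne_top).comp h1
    rw [ENNReal.toReal_zero] at h2'
    have h3 : Tendsto (fun τ : ℝ => a + τ) atTop atTop := tendsto_atTop_add_const_left _ _ tendsto_id
    exact (h2'.comp h3).congr fun σ => by simp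
  have lim_g : Tendsto (fun τ : ℝ => D * (a + τ) ^ (-(1 / 2 : ℝ)) * Cπ) atTop (𝓝 0) := by
    have h3 : Tendsto (fun τ : ℝ => a + τ) atTop atTop := tendsto_atTop_add_const_left _ _ tendsto_id
    have h1 : Tendsto (fun τ : ℝ => (a + τ) ^ (-(1 / 2 : ℝ))) atTop (𝓝 0) :=
      (tendsto_rpow_neg_atTop (y := 1 / 2) (by norm_num)).comp h3
    simpa only [mul_zero, zero_mul] using (h1.const_mul D).mul_const Cπ
  refine squeeze_zero' (g := fun τ : ℝ =>
      ‖UnboundedOperators.heatExtension (locVelocity χ u s) (a + τ) 0‖ + D * (a + τ) ^ (-(1 / 2 : ℝ)) * Cπ)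
    (Eventually.of_forall fun τ => norm_nonneg _) ?_ (by simpa only [add_zero] using lim_v.add lim_g)
  filter_upwards [eventually_gt_atTop (-a)] with τ hτ
  have hσ : 0 < a + τ := by linarith
  rw [show locSolPart χ u s = fun z => locVelocity χ u s z - gradient (locPotential χ u s) z from rfl,
    UnboundedOperators.heatExtension_sub_of_bound hv.continuous hg (fun z => hCv (mem_range_self z)) hCg hσ 0]
  refine (norm_sub_le _ _).trans (add_le_add le_rfl ?_)
  rw [show locPotential χ u s = divPotential (locVelocity χ u s) from rfl,
    heatExtension_gradient_divPotential hv hvc hσ 0, gradient, LinearIsometryEquiv.norm_map]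
  exact UnboundedOperators.norm_fderiv_heatExtension_le_of_bounded hπ1.continuous.aestronglyMeasurable
    (fun z => (Real.norm_eq_abs _).le.trans (hCπ z)) hσ 0

/-- **The residual of the representation vanishes identically** (`t > s₀`). [cite: LemarieRieusset2016, Def. 6.5 with Thm. 6.1] -/
theorem residual_eq_zero (x : EuclideanSpace ℝ (Fin 3)) :
    locSolPart χ u t x - locDatum χ u s₀ t x
        + oseenDuhamel 1 s₀ (locVelocity χ u) (locExtension x₁ R u) t x
        + oseenDuhamel 1 s₀ (fun _ y => (2 : ℝ) • gradient χ y) (locExtension x₁ R u) t x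
        - locForcing χ u p s₀ t x = 0 := by
  have hI : Icc s₀ t ⊆ Ioo (-δ) (R ^ 2) := fun s hs => ⟨hs₀.trans_le hs.1, hs.2.trans_lt htR⟩
  have hs₀S : s₀ ∈ Ioo (-δ) (R ^ 2) := hI (left_mem_Icc.2 hst.le)
  have htS : t ∈ Ioo (-δ) (R ^ 2) := hI (right_mem_Icc.2 hst.le)
  have htI : t ∈ Icc s₀ t := right_mem_Icc.2 hst.le
  have hσ₀ : 0 < t - s₀ := sub_pos.2 hst
  obtain ⟨M, hM0, hvM, hũM, hgM⟩ := exists_slab_bound hsol hχ hI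
  have hvm := aestronglyMeasurable_uncurry_locVelocity hsol hχ hI
  have hũm := aestronglyMeasurable_uncurry_locExtension hsol hI
  have hgm := aestronglyMeasurable_uncurry_gradCutoff hχ (Ioo s₀ t ×ˢ (univ : Set (EuclideanSpace ℝ (Fin 3))))
  obtain ⟨CA, hCA⟩ := exists_forall_norm_locSolPart_le hsol hχ htS
  obtain ⟨CA₀, hCA₀⟩ := exists_forall_norm_locSolPart_le hsol hχ hs₀S
  obtain ⟨hDc, hDb, -⟩ := locDatum_regular hsol hχ hs₀S hCA₀ t
  obtain ⟨CB, -, hCB⟩ := exists_norm_oseenDuhamel_bounded_le (E := EuclideanSpace ℝ (Fin 3))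
  obtain ⟨CF, -, hCF⟩ := exists_norm_locForcing_le hsol hχ hI
  -- the five terms as functions, their continuity and `L^∞` classes
  set A : EuclideanSpace ℝ (Fin 3) → EuclideanSpace ℝ (Fin 3) := locSolPart χ u t with hA
  set Dt : EuclideanSpace ℝ (Fin 3) → EuclideanSpace ℝ (Fin 3) := locDatum χ u s₀ t with hDt
  set B₁ : EuclideanSpace ℝ (Fin 3) → EuclideanSpace ℝ (Fin 3) :=
    oseenDuhamel 1 s₀ (locVelocity χ u) (locExtension x₁ R u) t with hB₁
  set B₂ : EuclideanSpace ℝ (Fin 3) → EuclideanSpace ℝ (Fin 3) :=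
    oseenDuhamel 1 s₀ (fun _ y => (2 : ℝ) • gradient χ y) (locExtension x₁ R u) t with hB₂
  set F : EuclideanSpace ℝ (Fin 3) → EuclideanSpace ℝ (Fin 3) := locForcing χ u p s₀ t with hF
  have hAc : Continuous A := (contDiff_locSolPart hsol hχ htS).continuous
  have hB₁c : Continuous B₁ := continuous_oseenDuhamel_slice one_pos hM0 hvm hũm hvM hũM hst le_rfl
  have hB₂c : Continuous B₂ := continuous_oseenDuhamel_slice one_pos hM0 hgm hũm hgM hũM hst le_rfl
  have hFc : Continuous F := continuous_locForcing hsol hχ hI htI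
  have mA : MemLp A ∞ (volume : Measure (EuclideanSpace ℝ (Fin 3))) :=
    memLp_top_of_bound hAc.aestronglyMeasurable _ (Eventually.of_forall hCA)
  have mD : MemLp Dt ∞ (volume : Measure (EuclideanSpace ℝ (Fin 3))) :=
    memLp_top_of_bound hDc.aestronglyMeasurable _ (Eventually.of_forall hDb)
  have mB₁ : MemLp B₁ ∞ (volume : Measure (EuclideanSpace ℝ (Fin 3))) :=
    memLp_top_of_bound hB₁c.aestronglyMeasurable _ (Eventually.of_forall (hCB one_pos hst hM0 hvM hũM))
  have mB₂ : MemLp B₂ ∞ (volume : Measure (EuclideanSpace ℝ (Fin 3))) :=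
    memLp_top_of_bound hB₂c.aestronglyMeasurable _ (Eventually.of_forall (hCB one_pos hst hM0 hgM hũM))
  have mF : MemLp F ∞ (volume : Measure (EuclideanSpace ℝ (Fin 3))) :=
    memLp_top_of_bound hFc.aestronglyMeasurable _ (Eventually.of_forall (hCF t htI))
  -- the residual is a.e. a constant `c`
  obtain ⟨c, hc⟩ := exists_residual_ae_eq_const hsol hχ hs₀ hst htR
  set z : EuclideanSpace ℝ (Fin 3) → EuclideanSpace ℝ (Fin 3) := A - Dt + B₁ + B₂ - F with hz
  have hzc : z =ᵐ[volume] fun _ => c := by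
    filter_upwards [hc] with y hy
    simpa [hz] using hy
  -- `c = e^{τΔ}z(0) = e^{τΔ}A(0) - e^{τΔ}Dt(0) + e^{τΔ}B₁(0) + e^{τΔ}B₂(0) - e^{τΔ}F(0)`
  have hcτ : ∀ τ : ℝ, 0 < τ → c = UnboundedOperators.heatExtension A τ 0 -
      UnboundedOperators.heatExtension Dt τ 0 + UnboundedOperators.heatExtension B₁ τ 0 +
      UnboundedOperators.heatExtension B₂ τ 0 - UnboundedOperators.heatExtension F τ 0 := by
    intro τ hτ
    have e1 : UnboundedOperators.heatExtension z τ 0 = c := by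
      rw [heatExtension_congr_ae hzc τ, UnboundedOperators.heatExtension_const c hτ 0]
    have e2 : UnboundedOperators.heatExtension z τ =
        UnboundedOperators.heatExtension A τ - UnboundedOperators.heatExtension Dt τ +
          UnboundedOperators.heatExtension B₁ τ + UnboundedOperators.heatExtension B₂ τ -
          UnboundedOperators.heatExtension F τ := by
      rw [hz, heatExtension_sub_eq_of_memLp (((mA.sub mD).add mB₁).add mB₂) mF le_top hτ,
        heatExtension_add_eq_of_memLp ((mA.sub mD).add mB₁) mB₂ le_top hτ,
        heatExtension_add_eq_of_memLp (mA.sub mD) mB₁ le_top hτ,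
        heatExtension_sub_eq_of_memLp mA mD le_top hτ]
    rw [← e1, e2]
    rfl
  -- ### every term tends to zero at the origin as `τ → ∞`
  have lim_A : Tendsto (fun τ : ℝ => ‖UnboundedOperators.heatExtension A τ 0‖) atTop (𝓝 0) := by
    simpa using tendsto_norm_heatExtension_locSolPart hsol hχ htS 0
  have lim_D : Tendsto (fun τ : ℝ => ‖UnboundedOperators.heatExtension Dt τ 0‖) atTop (𝓝 0) := by
    have h := tendsto_norm_heatExtension_locSolPart hsol hχ hs₀S (t - s₀)
    have mA₀ : MemLp (locSolPart χ u s₀) ∞ (volume : Measure (EuclideanSpace ℝ (Fin 3))) :=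
      memLp_top_of_bound (contDiff_locSolPart hsol hχ hs₀S).continuous.aestronglyMeasurable _
        (Eventually.of_forall hCA₀)
    refine (h.congr' ?_)
    filter_upwards [eventually_gt_atTop 0] with τ hτ
    rw [hDt, show locDatum χ u s₀ t = heatFlow (locSolPart χ u s₀) (t - s₀) from rfl,
      heatFlow_of_pos _ hσ₀, UnboundedOperators.heatExtension_add_holds mA₀ le_top hσ₀ hτ]
  obtain ⟨C₁, hC₁⟩ := exists_norm_heatExtension_oseenDuhamel_le_of_bound hvm hũm hM0 hvM hũM hst
  obtain ⟨C₂, hC₂⟩ := exists_norm_heatExtension_oseenDuhamel_le_of_bound hgm hũm hM0 hgM hũM hst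
  have lim_pow : Tendsto (fun τ : ℝ => τ ^ (-(1 / 2 : ℝ))) atTop (𝓝 0) :=
    tendsto_rpow_neg_atTop (by norm_num)
  have lim_B₁ : Tendsto (fun τ : ℝ => ‖UnboundedOperators.heatExtension B₁ τ 0‖) atTop (𝓝 0) := by
    refine squeeze_zero' (g := fun τ : ℝ => C₁ * τ ^ (-(1 / 2 : ℝ)))
      (Eventually.of_forall fun τ => norm_nonneg _) ?_ (by simpa only [mul_zero] using lim_pow.const_mul C₁)
    filter_upwards [eventually_gt_atTop 0] with τ hτ
    exact hC₁ hτ 0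
  have lim_B₂ : Tendsto (fun τ : ℝ => ‖UnboundedOperators.heatExtension B₂ τ 0‖) atTop (𝓝 0) := by
    refine squeeze_zero' (g := fun τ : ℝ => C₂ * τ ^ (-(1 / 2 : ℝ)))
      (Eventually.of_forall fun τ => norm_nonneg _) ?_ (by simpa only [mul_zero] using lim_pow.const_mul C₂)
    filter_upwards [eventually_gt_atTop 0] with τ hτ
    exact hC₂ hτ 0
  obtain ⟨C', -, hC'⟩ := exists_norm_heatExtension_locForcing_le hsol hχ hI
  have lim_F : Tendsto (fun τ : ℝ => ‖UnboundedOperators.heatExtension F τ 0‖) atTop (𝓝 0) := by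
    refine squeeze_zero' (g := fun τ : ℝ => C' * (t - s₀) * τ ^ (-(1 / 2 : ℝ)))
      (Eventually.of_forall fun τ => norm_nonneg _) ?_
      (by simpa only [mul_zero] using lim_pow.const_mul (C' * (t - s₀)))
    filter_upwards [eventually_ge_atTop 1] with τ hτ
    exact hC' t htI hτ 0
  -- hence `c = 0`
  have hc0 : c = 0 := by
    have hlim : Tendsto (fun τ : ℝ => ‖UnboundedOperators.heatExtension A τ 0‖ +
        ‖UnboundedOperators.heatExtension Dt τ 0‖ + ‖UnboundedOperators.heatExtension B₁ τ 0‖ +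
        ‖UnboundedOperators.heatExtension B₂ τ 0‖ + ‖UnboundedOperators.heatExtension F τ 0‖)
        atTop (𝓝 0) := by
      simpa using (((lim_A.add lim_D).add lim_B₁).add lim_B₂).add lim_F
    have hle : ∀ᶠ τ : ℝ in atTop, ‖c‖ ≤ ‖UnboundedOperators.heatExtension A τ 0‖ +
        ‖UnboundedOperators.heatExtension Dt τ 0‖ + ‖UnboundedOperators.heatExtension B₁ τ 0‖ +
        ‖UnboundedOperators.heatExtension B₂ τ 0‖ + ‖UnboundedOperators.heatExtension F τ 0‖ := by
      filter_upwards [eventually_gt_atTop 0] with τ hτ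
      rw [hcτ τ hτ]
      set a₁ := UnboundedOperators.heatExtension A τ 0
      set a₂ := UnboundedOperators.heatExtension Dt τ 0
      set a₃ := UnboundedOperators.heatExtension B₁ τ 0
      set a₄ := UnboundedOperators.heatExtension B₂ τ 0
      set a₅ := UnboundedOperators.heatExtension F τ 0
      calc ‖a₁ - a₂ + a₃ + a₄ - a₅‖ ≤ ‖a₁ - a₂ + a₃ + a₄‖ + ‖a₅‖ := norm_sub_le _ _
        _ ≤ ‖a₁ - a₂ + a₃‖ + ‖a₄‖ + ‖a₅‖ := by gcongr; exact norm_add_le _ _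
        _ ≤ ‖a₁ - a₂‖ + ‖a₃‖ + ‖a₄‖ + ‖a₅‖ := by gcongr; exact norm_add_le _ _
        _ ≤ ‖a₁‖ + ‖a₂‖ + ‖a₃‖ + ‖a₄‖ + ‖a₅‖ := by gcongr; exact norm_sub_le _ _
    have h0 : ‖c‖ ≤ 0 := ge_of_tendsto hlim hle
    exact norm_le_zero_iff.1 h0
  -- ### `z = 0` a.e. and `z` continuous, hence `z = 0` everywhere
  have hzcont : Continuous z := by
    rw [hz]
    exact (((hAc.sub hDc).add hB₁c).add hB₂c).sub hFc
  have hz0 : z = fun _ => 0 := by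
    rw [hc0] at hzc
    exact (Continuous.ae_eq_iff_eq volume hzcont continuous_const).1 hzc
  have := congr_fun hz0 x
  simpa [hz] using this

end Vanishing

/-! ### The representation -/

/-- **Oseen representation of the localised classical solution** (Bradshaw–Grujić–Kukavica
2015, §4, (4.2)–(4.4), in the Oseen-tensor form of Lemarié-Rieusset 2016, Thm. 6.1): for
`-δ < s₀ ≤ t < R²` and every `x`,
`v(t,x) = ∇π[v(t)](x) + e^{(t-s₀)Δ}P[v(s₀)](x) - B¹_{s₀}(v, ũ)(t)(x) - B¹_{s₀}(2∇χ, ũ)(t)(x)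
  + ∫_{s₀}^{t} e^{(t-s)Δ}P[f₀(s)](x) ds`. [cite: BradshawGrujicKukavica2015, §4 (4.2)–(4.4)] [cite: LemarieRieusset2016, Thm. 6.1] -/
theorem locVelocity_eq_representation (hsol : IsCylinderSolution x₁ δ R u p) (hχ : IsLocCutoff x₁ R χ)
    {s₀ t : ℝ} (hs₀ : -δ < s₀) (hs₀t : s₀ ≤ t) (htR : t < R ^ 2) (x : EuclideanSpace ℝ (Fin 3)) :
    locVelocity χ u t x = locGradPart χ u t x + locDatum χ u s₀ t x
      - oseenDuhamel 1 s₀ (locVelocity χ u) (locExtension x₁ R u) t x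
      - oseenDuhamel 1 s₀ (fun _ y => (2 : ℝ) • gradient χ y) (locExtension x₁ R u) t x
      + locForcing χ u p s₀ t x := by
  rcases hs₀t.eq_or_lt with rfl | hst
  · have h0 : ∀ (w₁ w₂ : ℝ → EuclideanSpace ℝ (Fin 3) → EuclideanSpace ℝ (Fin 3)),
        oseenDuhamel 1 s₀ w₁ w₂ s₀ x = 0 := fun w₁ w₂ => by
      rw [oseenDuhamel_apply, Ioo_self, Measure.restrict_empty, integral_zero_measure]
    rw [h0, h0, locForcing_self, locDatum_self, sub_zero, sub_zero, add_zero, add_comm,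
      locSolPart_add_locGradPart]
  · have h := residual_eq_zero hsol hχ hs₀ hst htR x
    have hsplit := locSolPart_add_locGradPart (χ := χ) (u := u) (t := t) (x := x)
    -- `v = a + b` and `a = Dt - B₁ - B₂ + F`
    have ha : locSolPart χ u t x = locDatum χ u s₀ t x
        - oseenDuhamel 1 s₀ (locVelocity χ u) (locExtension x₁ R u) t x
        - oseenDuhamel 1 s₀ (fun _ y => (2 : ℝ) • gradient χ y) (locExtension x₁ R u) t x
        + locForcing χ u p s₀ t x := by
      rw [← sub_eq_zero]
      rw [← h]
      abel
    rw [← hsplit, ha]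
    abel

end BGK2015

end Literature.Analysis.FluidPDE
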